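import Summits.RiemannHypothesis.RiemannHypothesis.Theorems.Splittings.ScrewNullCombUniqueness
import Summits.RiemannHypothesis.RiemannHypothesis.Theorems.Splittings.ScrewNullCombExpansion

/-!
# Splittings — SCREW NULL COMBINATIONS IV: coefficients on and right of the critical line vanish

Cell rh-split (brief sha16 f79c5f09d8bcb036), seat rh-split-typer-2 g3 (prover; own initiative on the cross/screw column,
announced HOME/STATUS.md 01:50Z): residual **R2** of target T2 (`ETAIL ⟺ FOZ`) of `cards/SPLIT-screw-bridge.md` §8/§9.  The seat
rh-split-screw-bridge g4 re-expressed R2 («FOZ ⟹ the screw Gram matrices are eventually nonsingular») as «FOZ ⟹ NNC»,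
NNC = «no non-zero finite real combination `t ↦ Σ_{j<n} z_j G_g(t, log(j+2))` of kernel sections vanishes at every node
`log(i+2)`» (`Splittings/ScrewBridgeRigidity.lean`, `inertiaOfFoz_iff_foz_imp_nnc`).  This file is part IV of VI, step (iii):
`coeff_eq_zero_of_tendsto_zeros` — for an absolutely summable coefficient family `a` on the non-trivial zeros and finitely many
off-line zeros, `Σ_ρ a(ρ)e^{(ρ−½)t} − A₀ → 0` forces `a(ρ) = 0` whenever `Re ρ ≥ ½`: the finitely many growing terms form a
bounded exponential sum (part I `coeff_eq_zero_of_bounded`), the finitely many decaying ones tend to `0`, and the on-line part is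
an absolutely convergent almost-periodic sum with the distinct frequencies `Im ρ` (part I `const_eq_zero_of_tendsto`,
`coeff_eq_zero_of_tendsto`).  [folklore].

HONEST LABEL: an RH-free theorem about Suzuki's screw kernel GIVEN finitely many off-line zeros; it discharges the residual
R2 of a CONDITIONAL bridge (cell rh-split: «SPLITTING SEARCH over kernel-typed RH-EQUIVALENCES; a splitting A ∧ B ⟹ RH is
CONDITIONAL bookkeeping unless A and B are both proved») and nothing here bears on the truth of RH.
-/

set_option linter.dupNamespace false

noncomputable section

namespace Summit.RiemannHypothesis.RiemannHypothesis.Theorems.Splittings.ScrewNullComb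


open Filter Topology Complex Finset
open Literature.NumberTheory.LFunctions

/-- On the critical line `ρ − ½ = i·Im ρ`. [folklore] -/
theorem sub_half_eq_im_mul_I {ρ : ℂ} (h : ρ.re = 1 / 2) : ρ - 1 / 2 = (ρ.im : ℂ) * I :=
  Complex.ext (by simp [h]) (by simp)

/-- Norm of `e^{(ρ−½)t}`: `e^{(Re ρ − ½)t}`. [folklore] -/
theorem norm_exp_sub_half_mul (ρ : ℂ) (t : ℝ) :
    ‖Complex.exp ((ρ - 1 / 2) * t)‖ = Real.exp ((ρ.re - 1 / 2) * t) := by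
  rw [Complex.norm_exp]; congr 1; simp

/-- **Step (iii).** Let `a : {non-trivial zeros} → ℂ` be absolutely summable and suppose only finitely many non-trivial
zeros lie off the critical line.  If `Σ_ρ a(ρ) e^{(ρ−½)t} − A₀ → 0` as `t → +∞` for some constant `A₀`, then `a(ρ) = 0`
for every zero with `Re ρ ≥ ½`: the finitely many growing terms by `coeff_eq_zero_of_bounded`, then (after `A₀ = 0` by
`const_eq_zero_of_tendsto`) the almost-periodic on-line part by `coeff_eq_zero_of_tendsto`; the finitely many decaying
terms (`Re ρ < ½`) tend to zero and play no role. [folklore] -/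
theorem coeff_eq_zero_of_tendsto_zeros (a : ZetaZeros.riemannZetaNontrivialZeros → ℂ)
    (ha : Summable fun ρ ↦ ‖a ρ‖)
    (hO : Set.Finite {ρ : ZetaZeros.riemannZetaNontrivialZeros | (ρ : ℂ).re ≠ 1 / 2}) (A₀ : ℂ)
    (h : Tendsto (fun t : ℝ ↦ (∑' ρ : ZetaZeros.riemannZetaNontrivialZeros,
        a ρ * Complex.exp (((ρ : ℂ) - 1 / 2) * t)) - A₀) atTop (𝓝 0)) :
    (∀ ρ : ZetaZeros.riemannZetaNontrivialZeros, 1 / 2 < (ρ : ℂ).re → a ρ = 0) ∧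
      (∀ ρ : ZetaZeros.riemannZetaNontrivialZeros, (ρ : ℂ).re = 1 / 2 → a ρ = 0) := by
  classical
  set O : Finset ZetaZeros.riemannZetaNontrivialZeros := hO.toFinset with hOdef
  have hOmem : ∀ ρ, ρ ∈ O ↔ (ρ : ℂ).re ≠ 1 / 2 := fun ρ ↦ by
    rw [hOdef, Set.Finite.mem_toFinset]; rfl
  -- pointwise summability of the exponential family
  have hS : ∀ t : ℝ, Summable fun ρ : ZetaZeros.riemannZetaNontrivialZeros ↦
      a ρ * Complex.exp (((ρ : ℂ) - 1 / 2) * t) := fun t ↦ by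
    refine Summable.of_norm_bounded (ha.mul_right (Real.exp (|t| / 2))) fun ρ ↦ ?_
    rw [norm_mul]
    exact mul_le_mul_of_nonneg_left (norm_exp_mul_le (abs_re_sub_half_le ρ) t) (norm_nonneg _)
  -- the on-line part `G₀`, the growing part `E`, the decaying part `D`
  set G₀ : ℝ → ℂ := fun t ↦ ∑' ρ : {ρ // ρ ∉ O}, a ρ * Complex.exp ((((ρ : ZetaZeros.riemannZetaNontrivialZeros) : ℂ).im : ℂ) * I * t)
    with hG₀
  set Op : Finset ZetaZeros.riemannZetaNontrivialZeros := O.filter fun ρ ↦ 1 / 2 < (ρ : ℂ).re with hOp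
  set Om : Finset ZetaZeros.riemannZetaNontrivialZeros := O.filter fun ρ ↦ ¬ 1 / 2 < (ρ : ℂ).re with hOm
  set E : ℝ → ℂ := fun t ↦ ∑ ρ ∈ Op, a ρ * Complex.exp (((ρ : ℂ) - 1 / 2) * t) with hE
  set D : ℝ → ℂ := fun t ↦ ∑ ρ ∈ Om, a ρ * Complex.exp (((ρ : ℂ) - 1 / 2) * t) with hD
  have hsplit : ∀ t : ℝ, ∑' ρ : ZetaZeros.riemannZetaNontrivialZeros, a ρ * Complex.exp (((ρ : ℂ) - 1 / 2) * t)
      = E t + D t + G₀ t := by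
    intro t
    rw [← (hS t).sum_add_tsum_subtype_compl O, ← Finset.sum_filter_add_sum_filter_not O (fun ρ ↦ 1 / 2 < (ρ : ℂ).re)]
    congr 1
    refine tsum_congr fun ρ ↦ ?_
    have hre : ((ρ : ZetaZeros.riemannZetaNontrivialZeros) : ℂ).re = 1 / 2 := by
      have := ρ.2; rw [hOmem] at this; push Not at this; exact this
    rw [sub_half_eq_im_mul_I hre]
  -- `D → 0`
  have hD0 : Tendsto D atTop (𝓝 0) := by
    rw [hD, show (0 : ℂ) = ∑ ρ ∈ Om, 0 by simp]
    refine tendsto_finsetSum _ fun ρ hρ ↦ ?_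
    have hρ' := Finset.mem_filter.1 hρ
    have hne : (ρ : ℂ).re ≠ 1 / 2 := (hOmem ρ).1 hρ'.1
    have hlt : (ρ : ℂ).re - 1 / 2 < 0 := by
      have := lt_of_le_of_ne (not_lt.1 hρ'.2) hne
      linarith
    rw [tendsto_zero_iff_norm_tendsto_zero]
    have e : (fun t : ℝ ↦ ‖a ρ * Complex.exp (((ρ : ℂ) - 1 / 2) * t)‖) =
        fun t ↦ ‖a ρ‖ * Real.exp (((ρ : ℂ).re - 1 / 2) * t) := by
      funext t; rw [norm_mul, norm_exp_sub_half_mul]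
    rw [e]
    have h1 : Tendsto (fun t : ℝ ↦ ((ρ : ℂ).re - 1 / 2) * t) atTop atBot :=
      tendsto_id.const_mul_atTop_of_neg hlt
    simpa using (Real.tendsto_exp_atBot.comp h1).const_mul ‖a ρ‖
  -- `G₀` is bounded
  have haO : Summable fun ρ : {ρ // ρ ∉ O} ↦ ‖a ρ‖ := ha.subtype _
  have hG₀b : ∀ t : ℝ, ‖G₀ t‖ ≤ ∑' ρ : {ρ // ρ ∉ O}, ‖a ρ‖ := by
    intro t
    have hs : Summable fun ρ : {ρ // ρ ∉ O} ↦
        ‖a ρ * Complex.exp ((((ρ : ZetaZeros.riemannZetaNontrivialZeros) : ℂ).im : ℂ) * I * t)‖ :=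
      haO.congr fun ρ ↦ by rw [norm_mul, norm_exp_ofReal_mul_I_mul, mul_one]
    refine (norm_tsum_le_tsum_norm hs).trans (le_of_eq (tsum_congr fun ρ ↦ ?_))
    rw [norm_mul, norm_exp_ofReal_mul_I_mul, mul_one]
  -- `E` is eventually bounded, hence zero by `coeff_eq_zero_of_bounded`
  have hEb : ∃ M T₀ : ℝ, ∀ t ≥ T₀, ‖E t‖ ≤ M := by
    have h1 : ∀ᶠ t : ℝ in atTop, ‖(∑' ρ : ZetaZeros.riemannZetaNontrivialZeros,
        a ρ * Complex.exp (((ρ : ℂ) - 1 / 2) * t)) - A₀‖ ≤ 1 := by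
      have := (tendsto_zero_iff_norm_tendsto_zero.1 h)
      exact (this.eventually (ge_mem_nhds (by norm_num : (0 : ℝ) < 1)))
    have h2 : ∀ᶠ t : ℝ in atTop, ‖D t‖ ≤ 1 :=
      (tendsto_zero_iff_norm_tendsto_zero.1 hD0).eventually (ge_mem_nhds (by norm_num : (0 : ℝ) < 1))
    obtain ⟨T₀, hT₀⟩ := (h1.and h2).exists_forall_of_atTop
    refine ⟨1 + ‖A₀‖ + (∑' ρ : {ρ // ρ ∉ O}, ‖a ρ‖) + 1, T₀, fun t ht ↦ ?_⟩
    obtain ⟨h1t, h2t⟩ := hT₀ t ht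
    have e : E t = ((∑' ρ : ZetaZeros.riemannZetaNontrivialZeros,
        a ρ * Complex.exp (((ρ : ℂ) - 1 / 2) * t)) - A₀) + A₀ - D t - G₀ t := by
      rw [hsplit t]; ring
    rw [e]
    calc ‖(∑' ρ : ZetaZeros.riemannZetaNontrivialZeros, a ρ * Complex.exp (((ρ : ℂ) - 1 / 2) * t)) - A₀ + A₀ - D t - G₀ t‖
        ≤ ‖(∑' ρ : ZetaZeros.riemannZetaNontrivialZeros, a ρ * Complex.exp (((ρ : ℂ) - 1 / 2) * t)) - A₀‖ + ‖A₀‖ + ‖D t‖ + ‖G₀ t‖ := by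
          have := norm_sub_le ((∑' ρ : ZetaZeros.riemannZetaNontrivialZeros, a ρ * Complex.exp (((ρ : ℂ) - 1 / 2) * t)) - A₀ + A₀ - D t) (G₀ t)
          have := norm_sub_le ((∑' ρ : ZetaZeros.riemannZetaNontrivialZeros, a ρ * Complex.exp (((ρ : ℂ) - 1 / 2) * t)) - A₀ + A₀) (D t)
          have := norm_add_le ((∑' ρ : ZetaZeros.riemannZetaNontrivialZeros, a ρ * Complex.exp (((ρ : ℂ) - 1 / 2) * t)) - A₀) A₀
          linarith
      _ ≤ 1 + ‖A₀‖ + (∑' ρ : {ρ // ρ ∉ O}, ‖a ρ‖) + 1 := by linarith [hG₀b t]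
  -- transport `E` to an exponent-indexed sum
  set c : ℂ → ℂ := fun x ↦ if hx : x + 1 / 2 ∈ ZetaZeros.riemannZetaNontrivialZeros then a ⟨x + 1 / 2, hx⟩ else 0 with hc
  have hcval : ∀ ρ : ZetaZeros.riemannZetaNontrivialZeros, c ((ρ : ℂ) - 1 / 2) = a ρ := by
    intro ρ
    have hx : (ρ : ℂ) - 1 / 2 + 1 / 2 ∈ ZetaZeros.riemannZetaNontrivialZeros := by rw [sub_add_cancel]; exact ρ.2
    have e : (⟨(ρ : ℂ) - 1 / 2 + 1 / 2, hx⟩ : ZetaZeros.riemannZetaNontrivialZeros) = ρ := Subtype.ext (by simp)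
    simp only [hc, dif_pos hx, e]
  set s : Finset ℂ := Op.image (fun ρ : ZetaZeros.riemannZetaNontrivialZeros ↦ (ρ : ℂ) - 1 / 2) with hs
  have hinj : Set.InjOn (fun ρ : ZetaZeros.riemannZetaNontrivialZeros ↦ (ρ : ℂ) - 1 / 2) ↑Op :=
    fun ρ₁ _ ρ₂ _ hρ ↦ Subtype.ext (sub_left_injective hρ)
  have hEs : ∀ t : ℝ, ∑ x ∈ s, c x * Complex.exp (x * t) = E t := by
    intro t
    rw [hs, Finset.sum_image hinj]
    exact Finset.sum_congr rfl fun ρ _ ↦ by rw [hcval]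
  have hspos : ∀ x ∈ s, 0 < x.re := by
    intro x hx
    rw [hs, Finset.mem_image] at hx
    obtain ⟨ρ, hρ, rfl⟩ := hx
    have := (Finset.mem_filter.1 hρ).2
    simp only [sub_re]
    norm_num at this ⊢
    linarith
  have hEb' : ∃ M T₀ : ℝ, ∀ t ≥ T₀, ‖∑ x ∈ s, c x * Complex.exp (x * t)‖ ≤ M := by
    obtain ⟨M, T₀, hM⟩ := hEb; exact ⟨M, T₀, fun t ht ↦ by rw [hEs]; exact hM t ht⟩
  have hczero := coeff_eq_zero_of_bounded s c hspos hEb'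
  have hgrow : ∀ ρ : ZetaZeros.riemannZetaNontrivialZeros, 1 / 2 < (ρ : ℂ).re → a ρ = 0 := by
    intro ρ hρ
    have hρO : ρ ∈ Op := Finset.mem_filter.2 ⟨(hOmem ρ).2 (by linarith), hρ⟩
    have := hczero ((ρ : ℂ) - 1 / 2) (by rw [hs]; exact Finset.mem_image_of_mem _ hρO)
    rwa [hcval] at this
  refine ⟨hgrow, ?_⟩
  -- `E ≡ 0`, so `-A₀ + G₀ → 0`
  have hE0 : ∀ t, E t = 0 := fun t ↦ Finset.sum_eq_zero fun ρ hρ ↦ by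
    rw [hgrow ρ (Finset.mem_filter.1 hρ).2, zero_mul]
  have hG : Tendsto (fun t : ℝ ↦ -A₀ + G₀ t) atTop (𝓝 0) := by
    have := h.sub hD0
    rw [sub_zero] at this
    refine this.congr fun t ↦ ?_
    rw [hsplit t, hE0 t]; ring
  have hμ : ∀ ρ : {ρ // ρ ∉ O}, a ρ ≠ 0 → ((ρ : ZetaZeros.riemannZetaNontrivialZeros) : ℂ).im ≠ 0 :=
    fun ρ _ ↦ ZetaZeros.riemannZetaNontrivialZeros.im_ne_zero ρ.1.2
  have hA₀ : -A₀ = 0 := const_eq_zero_of_tendsto (ι := {ρ // ρ ∉ O}) (c := fun ρ ↦ a ρ) haO hμ hG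
  rw [hA₀] at hG
  simp only [zero_add] at hG
  have hinjμ : Function.Injective fun ρ : {ρ // ρ ∉ O} ↦ ((ρ : ZetaZeros.riemannZetaNontrivialZeros) : ℂ).im := by
    intro ρ₁ ρ₂ hρ
    have h1 : ((ρ₁ : ZetaZeros.riemannZetaNontrivialZeros) : ℂ).re = 1 / 2 := by
      have := ρ₁.2; rw [hOmem] at this; push Not at this; exact this
    have h2 : ((ρ₂ : ZetaZeros.riemannZetaNontrivialZeros) : ℂ).re = 1 / 2 := by
      have := ρ₂.2; rw [hOmem] at this; push Not at this; exact this
    exact Subtype.ext (Subtype.ext (Complex.ext (by rw [h1, h2]) hρ))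
  have honline := coeff_eq_zero_of_tendsto (ι := {ρ // ρ ∉ O}) (c := fun ρ ↦ a ρ) haO hinjμ hG
  intro ρ hρ
  have hρO : ρ ∉ O := fun h' ↦ (hOmem ρ).1 h' hρ
  exact honline ⟨ρ, hρO⟩

end Summit.RiemannHypothesis.RiemannHypothesis.Theorems.Splittings.ScrewNullComb

end
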